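import Summits.NavierStokesRegularity.NavierStokesRegularity.Theorems.QuarterLogPincerQuietCoreSubcriticalUpgrade
import Summits.NavierStokesRegularity.NavierStokesRegularity.Theorems.QuarterLogPincerTypeIQuantSubcubicExpTruncationEdgeEnvelopeCubeBudget
import Summits.NavierStokesRegularity.NavierStokesRegularity.Theorems.QuarterLogPincerThinCascadeDefs
import HarnessLib

/-!
# Uniform late loudness of enveloped singular Type-I ancient fields — refuter side, negative lane, BY NAME

Crux `stmt-NavierStokesRegularity-24077` (`QuarterLogPincer.TypeIQuantSubcubicExp`). The quiet-core propagation
QC of line `quiet_core` (ns-idea-7 g10) is an unconditional TREE theorem by name since the typer's port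
(`…Cruxes.TypeIQuantSubcubicExp.QuietCore.quietCore_all : ∀ M B, QuietCore M B`, module
`…Theorems.QuarterLogPincerQuietCoreSubcriticalUpgrade`). This file combines it, by name, with the landed cube
budget of the envelope (T3, `lintegral_ball_enorm_cube_le_of_hasTypeIDecay`, whose constant `3·|B₁|·A³` is here
EXPOSED as `CubeBudgetWith (3·|B₁|·A³) v`) and with `ThinCascade.SingularAt`, and records the consequence the
instrument seat reads off for the Type-I (R)DSS candidate family:

* (L1) `exists_quietCore_of_envelope`: QC holds on the ENVELOPE class `IsTypeIAncientMild M v ∧ HasTypeIDecay A v`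
  with constants `c₀(M,A)`, `s₁(M,A)`, `K(M,A)` depending on `(M, A)` ONLY.
* (L2) `not_singularAt_of_quiet_late_slice`: ONE `c₀(M,A)`-quiet unit-core slice at a late time `s ∈ [s₁, 0)`
  forces regularity of the apex (`¬ SingularAt v 0`).
* (L3) `exists_uniform_loud_of_envelopedSingular`: every SINGULAR member is LOUD on the unit core at EVERY late
  time — `∃ x ∈ B(0,1), c₀(M,A)/√(−s) < ‖v(s,x)‖` for all `s ∈ [s₁(M,A), 0)` — a rate floor whose constant is
  UNIFORM over the class (the rung `LocalRateFloor` gives a field-dependent constant only);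
  (L3′) `localRateFloor_uniform_of_envelopedSingular` restates it in the vocabulary of line `quiet_collar` (`LocalRateFloor`, body verbatim).

Reading for the instrument (items 24453 / 24077-S3, DSS wall): the smooth representative of any hypothetical
Type-I (rotated-)`λ`-DSS profile is an enveloped singular member (landed
`LerayQuarterDissipation…Hardness.not_finiteDissipationLiouville_of_isTypeIDSSProfile` passes through exactly this
stratum), so (L3) is a UNIFORM unit-core amplitude floor `c₀(M,A)` for the whole candidate family: one quiet late
slice kills a candidate. The line's own workfile `quiet_core` v1.8 §7/§E (ns-idea-7 g11) carries the analogous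
`M`-only uniform apex floors on the THIN (energy) class; this file is the envelope-class statement over TREE modules.
Honest label: these are theorems about HYPOTHETICAL objects — under item stmt-4050
(`TypeIAncientLiouville`) the class is `{0}` and (L2)/(L3) are vacuous; nothing here asserts or refutes 24077,
24453, 22144 or 4050, and no summit statement is proved by this file. [folklore]
-/

-- the summit and its single sub-problem share the name (CONVENTIONS §1), as in every Theorems file
set_option linter.dupNamespace false

namespace Summit.NavierStokesRegularity.NavierStokesRegularity.Theorems.TypeIQuantSubcubicExp.Negative

open MeasureTheory Set Metric Function
open Literature.Analysis Literature.Analysis.FluidPDE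
open Summit.NavierStokesRegularity.NavierStokesRegularity.Cruxes.TypeIQuantSubcubicExp
open Summit.NavierStokesRegularity.NavierStokesRegularity.Cruxes.TypeIQuantSubcubicExp.ThinCascade (SingularAt)
open Summit.NavierStokesRegularity.NavierStokesRegularity.Cruxes.TypeIQuantSubcubicExp.TruncationEdge
open Summit.NavierStokesRegularity.NavierStokesRegularity.Cruxes.TypeIQuantSubcubicExp.QuietCore
open scoped ENNReal NNReal

/-! ### T3 with the budget constant exposed -/

/-- **The envelope's log-cube budget with its constant EXPOSED**: `HasTypeIDecay A v`, `A ≥ 0` ⇒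
`CubeBudgetWith (3·|B₁|·A³) v` (the landed T3 computation `lintegral_ball_enorm_cube_le_of_hasTypeIDecay`, by
name; the landed `envelopeCubeBudget_of_hasTypeIDecay` hides the same constant behind `∃ B`). [folklore] -/
theorem cubeBudgetWith_of_hasTypeIDecay {A : ℝ}
    {v : ℝ → EuclideanSpace ℝ (Fin 3) → EuclideanSpace ℝ (Fin 3)}
    (hA : 0 ≤ A) (hdec : HasTypeIDecay A v) :
    CubeBudgetWith (3 * (volume : Measure (EuclideanSpace ℝ (Fin 3))).real (ball 0 1) * A ^ 3) v := by
  set VB : ℝ := (volume : Measure (EuclideanSpace ℝ (Fin 3))).real (ball 0 1) with hVB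
  have hVB0 : 0 ≤ VB := measureReal_nonneg
  have hA3 : 0 ≤ A ^ 3 := pow_nonneg hA 3
  refine ⟨by positivity, fun R hR ε hε => ?_⟩
  have hlogR : 0 ≤ Real.log R := Real.log_nonneg (by linarith)
  have hlogε : 0 ≤ Real.log (1 / ε) := Real.log_nonneg (by rw [le_div_iff₀ hε.1]; linarith [hε.2])
  set Q : ℝ := 3 * VB * A ^ 3 * (1 + Real.log R + Real.log (1 / ε)) with hQ
  have hQ0 : 0 ≤ Q := by positivity
  refine ⟨Q ^ (1 / 3 : ℝ), Real.rpow_nonneg hQ0 _, ?_, fun s hs => ?_⟩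
  · rw [← Real.rpow_natCast, ← Real.rpow_mul hQ0]
    norm_num
  · have h3 : (3 : ℝ≥0∞).toReal = 3 := by norm_num
    rw [eLpNorm_eq_lintegral_rpow_enorm_toReal (by norm_num) (by norm_num), h3]
    have hind : (fun x => ‖(ball (0 : EuclideanSpace ℝ (Fin 3)) R).indicator (v s) x‖ₑ ^ (3 : ℝ)) =
        (ball (0 : EuclideanSpace ℝ (Fin 3)) R).indicator (fun x => ‖v s x‖ₑ ^ (3 : ℝ)) := by
      funext x
      rw [enorm_indicator_eq_indicator_enorm]
      by_cases hx : x ∈ ball (0 : EuclideanSpace ℝ (Fin 3)) R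
      · rw [indicator_of_mem hx, indicator_of_mem hx]
      · rw [indicator_of_notMem hx, indicator_of_notMem hx, ENNReal.zero_rpow_of_pos (by norm_num)]
    rw [hind, lintegral_indicator measurableSet_ball]
    calc (∫⁻ x in ball (0 : EuclideanSpace ℝ (Fin 3)) R, ‖v s x‖ₑ ^ (3 : ℝ)) ^ (1 / (3 : ℝ))
        ≤ (ENNReal.ofReal Q) ^ (1 / (3 : ℝ)) :=
          ENNReal.rpow_le_rpow (lintegral_ball_enorm_cube_le_of_hasTypeIDecay hA hdec hR hε.1 hε.2 hs)
            (by norm_num)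
      _ = ENNReal.ofReal (Q ^ (1 / 3 : ℝ)) := ENNReal.ofReal_rpow_of_nonneg hQ0 (by norm_num)

/-! ### (L1) QC on the envelope class, constants uniform in `(M, A)` -/

/-- **(L1) Quiet-core propagation on the ENVELOPE class**, by name from the tree's `quietCore_all` and the
exposed budget: the quiet level `c₀`, the lateness `s₁` and the bound `K` depend on `(M, A)` only. [folklore] -/
theorem exists_quietCore_of_envelope (M A : ℝ) :
    ∃ c₀ s₁ K : ℝ, 0 < c₀ ∧ s₁ < 0 ∧ 0 ≤ K ∧
      ∀ v : ℝ → EuclideanSpace ℝ (Fin 3) → EuclideanSpace ℝ (Fin 3),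
        IsTypeIAncientMild M v → HasTypeIDecay A v →
        ∀ s ∈ Set.Ico s₁ 0,
          (∀ x ∈ Metric.ball (0 : EuclideanSpace ℝ (Fin 3)) 1, ‖v s x‖ ≤ c₀ / Real.sqrt (-s)) →
          ∀ t ∈ Set.Ico s 0, ∀ x ∈ Metric.ball (0 : EuclideanSpace ℝ (Fin 3)) (1 / 2),
            ‖v t x‖ ≤ K / Real.sqrt (-s) := by
  by_cases hA : 0 ≤ A
  · obtain ⟨c₀, s₁, K, hc₀, hs₁, hK, H⟩ :=
      quietCore_all M (3 * (volume : Measure (EuclideanSpace ℝ (Fin 3))).real (ball 0 1) * A ^ 3)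
    exact ⟨c₀, s₁, K, hc₀, hs₁, hK, fun v hv hdec => H v hv (cubeBudgetWith_of_hasTypeIDecay hA hdec)⟩
  · -- a negative envelope constant is absurd: `HasTypeIDecay A v` forces `0 ≤ A`
    refine ⟨1, -1, 0, one_pos, by norm_num, le_rfl, fun v _ hdec => absurd ?_ hA⟩
    have h := hdec (-1) (by norm_num) 0
    simp only [norm_zero, neg_neg, Real.sqrt_one, zero_add, div_one] at h
    exact (norm_nonneg _).trans h

/-! ### (L2) one quiet late slice forces a regular apex -/

/-- From a uniform bound near the apex, the apex is not singular. [folklore] -/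
theorem not_singularAt_zero_of_bound {v : ℝ → EuclideanSpace ℝ (Fin 3) → EuclideanSpace ℝ (Fin 3)}
    {s K' : ℝ} (hs : s < 0)
    (hb : ∀ t ∈ Set.Ico s 0, ∀ x ∈ Metric.ball (0 : EuclideanSpace ℝ (Fin 3)) (1 / 2), ‖v t x‖ ≤ K') :
    ¬ SingularAt v 0 := by
  intro hsing
  set r : ℝ := min (1 / 2) (Real.sqrt (-s)) with hr_def
  have hsq : 0 < Real.sqrt (-s) := Real.sqrt_pos.2 (by linarith)
  have hr : 0 < r := lt_min (by norm_num) hsq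
  obtain ⟨t, ht, y, hy, hlt⟩ := hsing r hr K'
  have hr2 : r ^ 2 ≤ -s := by
    have h1 : r ≤ Real.sqrt (-s) := min_le_right _ _
    have h2 : r ^ 2 ≤ Real.sqrt (-s) ^ 2 := by
      exact pow_le_pow_left₀ hr.le h1 2
    rwa [Real.sq_sqrt (by linarith)] at h2
  have ht' : t ∈ Set.Ico s 0 := ⟨by linarith [ht.1], ht.2⟩
  have hy' : y ∈ Metric.ball (0 : EuclideanSpace ℝ (Fin 3)) (1 / 2) :=
    Metric.ball_subset_ball (min_le_left _ _) hy
  exact (not_lt.2 (hb t ht' y hy')) hlt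

/-- **(L2) ONE QUIET LATE SLICE KILLS A CANDIDATE**: with the constants of (L1), a member of the envelope class
that is `c₀`-quiet on the unit core at some `s ∈ [s₁, 0)` is regular at the apex. [folklore] -/
theorem not_singularAt_of_quiet_late_slice (M A : ℝ) :
    ∃ c₀ s₁ : ℝ, 0 < c₀ ∧ s₁ < 0 ∧
      ∀ v : ℝ → EuclideanSpace ℝ (Fin 3) → EuclideanSpace ℝ (Fin 3),
        IsTypeIAncientMild M v → HasTypeIDecay A v →
        ∀ s ∈ Set.Ico s₁ 0,
          (∀ x ∈ Metric.ball (0 : EuclideanSpace ℝ (Fin 3)) 1, ‖v s x‖ ≤ c₀ / Real.sqrt (-s)) →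
          ¬ SingularAt v 0 := by
  obtain ⟨c₀, s₁, K, hc₀, hs₁, _, H⟩ := exists_quietCore_of_envelope M A
  exact ⟨c₀, s₁, hc₀, hs₁, fun v hv hdec s hs hq =>
    not_singularAt_zero_of_bound hs.2 (H v hv hdec s hs hq)⟩

/-! ### (L3) uniform late loudness of singular members -/

/-- **(L3) UNIFORM LATE LOUDNESS**: for the envelope class `(M, A)` there are `c₀ > 0` and `s₁ < 0` such that
EVERY member singular at the apex satisfies `∃ x ∈ B(0,1), c₀/√(−s) < ‖v(s,x)‖` at EVERY `s ∈ [s₁, 0)` — a rate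
floor with a constant uniform over the class (compare the field-dependent rung `LocalRateFloor`). [folklore] -/
theorem exists_uniform_loud_of_envelopedSingular (M A : ℝ) :
    ∃ c₀ s₁ : ℝ, 0 < c₀ ∧ s₁ < 0 ∧
      ∀ v : ℝ → EuclideanSpace ℝ (Fin 3) → EuclideanSpace ℝ (Fin 3),
        IsTypeIAncientMild M v → HasTypeIDecay A v → SingularAt v 0 →
        ∀ s ∈ Set.Ico s₁ 0, ∃ x ∈ Metric.ball (0 : EuclideanSpace ℝ (Fin 3)) 1,
          c₀ / Real.sqrt (-s) < ‖v s x‖ := by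
  obtain ⟨c₀, s₁, hc₀, hs₁, H⟩ := not_singularAt_of_quiet_late_slice M A
  refine ⟨c₀, s₁, hc₀, hs₁, fun v hv hdec hsing s hs => ?_⟩
  by_contra hq
  push Not at hq
  exact H v hv hdec s hs (fun x hx => hq x hx) hsing

/-- **(L3′) the same in the vocabulary of line `quiet_collar`**: every singular member of the envelope class has
`QuietCollar.LocalRateFloor v` (body verbatim on the right; that Defs module imports the route file, so it is not
imported here), with witnesses `(c, s₀) = (c₀(M,A), s₁(M,A))` uniform over the class. [folklore] -/
theorem localRateFloor_uniform_of_envelopedSingular (M A : ℝ) :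
    ∃ c₀ s₁ : ℝ, 0 < c₀ ∧ s₁ < 0 ∧
      ∀ v : ℝ → EuclideanSpace ℝ (Fin 3) → EuclideanSpace ℝ (Fin 3),
        IsTypeIAncientMild M v → HasTypeIDecay A v → SingularAt v 0 →
        (∀ s ∈ Set.Ico s₁ 0, ∃ x ∈ Metric.ball (0 : EuclideanSpace ℝ (Fin 3)) 1,
          c₀ / Real.sqrt (-s) ≤ ‖v s x‖) ∧
        (∃ c s₀ : ℝ, 0 < c ∧ s₀ < 0 ∧ ∀ s ∈ Set.Ico s₀ 0,
          ∃ x ∈ Metric.ball (0 : EuclideanSpace ℝ (Fin 3)) 1, c / Real.sqrt (-s) ≤ ‖v s x‖) := by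
  obtain ⟨c₀, s₁, hc₀, hs₁, H⟩ := exists_uniform_loud_of_envelopedSingular M A
  refine ⟨c₀, s₁, hc₀, hs₁, fun v hv hdec hsing => ?_⟩
  have hfl : ∀ s ∈ Set.Ico s₁ 0, ∃ x ∈ Metric.ball (0 : EuclideanSpace ℝ (Fin 3)) 1,
      c₀ / Real.sqrt (-s) ≤ ‖v s x‖ := fun s hs => by
    obtain ⟨x, hx, hlt⟩ := H v hv hdec hsing s hs
    exact ⟨x, hx, hlt.le⟩
  exact ⟨hfl, ⟨c₀, s₁, hc₀, hs₁, hfl⟩⟩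

end Summit.NavierStokesRegularity.NavierStokesRegularity.Theorems.TypeIQuantSubcubicExp.Negative
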